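import Summits.QuantumFields.YangMills.Theorems.BalabanUVNodesN07SplitClauseHeadKnit
import Summits.QuantumFields.YangMills.Theorems.BalabanUVNodesK0HalvingStepOfCoreGuardedChain
import HarnessLib

/-!
# N07 [B11] (= [15] = [Balaban1985Variational]) Sect. F, road of record R0′, S6 HEAD: **FROM THE KNIT TO THE V20-G STUB-1 TEXT** — `Prop8RegSepTopStepG` at the plan's guard and
# the shape `∃ c c₀ B₃ a₀ a₁, 2L² ≤ B₃ ∧ 0 < a₀ ∧ 0 < a₁ ∧ Prop8RegSepTopStepG F N suppDom (guard c c₀) B₃ a₀ a₁` (plan WORD V20 = G, I.37134; at `N = 2` this is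
# `Prop8StepCoPGAt F`), CLOSED MODULO [6] Prop. 6, the chart lane's `HCHART`, the budget `HLETTERS`∕`HBUDGET` and the (162)–(166♭) smallness letters; plus the existence of the
# guard constants is n07-w3 g7's `N07HalvingBudgetS3.exists_guardConstants` (by name)

Cell `pub-ymgap`, width seat `pub-ymgap-dag-n07-w4` g4 (sub-target S6 = the HEAD), CLAIM-6 ∕ INTENT-6 (cell bus).  `--kind proof --supports stmt-QuantumFields-27364 --as helper`
(K1⁹ per dag-lead KEY MAP v2); count-neutral; def-free.  [15] = [Balaban1985Variational]; [6] = [Balaban1985RegularSpaces]; [4] = [Balaban1984PropagatorsII].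

THE POINT.  FILE 5's knit (p633893) concludes the guarded per-datum token `DatumGaugeSplitTopStepCoreG … Mc ρ (V20-G guard) B₃ C θ Q κ a₀ a₁` modulo `hP6` + `HCHART` +
`HLETTERS`∕`HBUDGET`.  k0-s1-w3's guarded chain `K0HalvingStepOfCoreGuardedChain.prop8RegSepTopStepG_of_datumGaugeSplitCoreG` (p626878; `… ⇒ LocalLettersSplitTopStepCoreG ⇒
HalvingStepTopCoreG ⇒ HalvingStepTopG ⇒ Prop8RegSepTopStepG`, same guard, `Sup := suppDomOfRecord`) takes that token with V19's floor `2L² ≤ B₃` and the R0′ smallness letters to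
Prop. 8's top step under the same guard.  THIS FILE composes the two BY NAME (§1) and ∃-packages the result in the plan's V20-G stub-1 shape for every `N` (§2).  The knit's
four side conditions on the guard constants — `(44 + 4ρ + Mc + 3)·L ≤ c`, `Mc + 44 + 6ρ ≤ 2L^{c₀}`, `F.m ≤ c₀`, `a′ + 3 ≤ c₀` — are met by ONE choice: n07-w3 g7's
`N07HalvingBudgetS3.exists_guardConstants` (p634948, `c := (47 + 4ρ + Mc)·L`, `c₀ := max (max m (a′ + 3)) X`), and the ORDER OF CHOICES `ρ → (c, c₀) → B₃ → a₀` against the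
S3 cap and the smallness letters is their `exists_halvingBudget_S3_guard` — both BY NAME at knit time, not restated here.

WHAT IS PROVED (sorry-free; no definition; axioms standard).  §1 ★★★ `prop8RegSepTopStepG_of_prop6P_of_chart F N` (FILE 5 ∘ p626878); §2 ★★★
`prop8StepCoPGShape_of_prop6P_of_chart F N` (the V20-G stub-1 shape, every `N`; witnesses `c c₀ B₃ a₀ a₁` the letters themselves).
HONEST SCOPE.  Count-neutral by-name composition + one ∃-introduction + elementary arithmetic; [6] Prop. 6 (`hP6`), `HCHART` (the chart lane's per-datum deliverable — SPEC in
`pub-ymgap-dag-n07-w4/S6-HEAD-RECIPE.md` § UPDATE g4), `HLETTERS`∕`HBUDGET`, `0 < B₃`, `a₀ ≤ a0OfP`, `8C_HB_He^{−δ_Hρ} ≤ θ_H`, `2L² ≤ B₃`, the (162)–(166♭) smallness and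
`0 < a₀, a₁` are HYPOTHESES — displayed, NOT discharged, joint satisfiability at the record NOT claimed; NO stub is closed here (`stub_prop8StepCoP13` ∕ the V20-G
`stub_prop8StepCoPG13` NOT registered∕closed by this file); nothing of [15]∕[6]∕[4] ANALYSIS asserted; K0⁷ ∕ K1⁹ NOT closed; N07 ∕ N05 NOT discharged; counts unmoved (typed 28∕28
· discharged 5∕27); one finite 𝕋⁴ programme at fixed ε — the route closes the conditional finite-𝕋⁴ rung `BalabanLadder.UV` ONLY; the YM mass gap (Clay) is NOT proved by any of
this; nothing continuum ∕ ℝ⁴ ∕ OS.  No `sorry`, no `def`, no `instance`, no `notation`.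

RELATED IN THE TREE, NOT DUPLICATED: FILE 5 `N07SplitClauseHeadKnit` (CONSUMED); k0-s1-w3 `K0HalvingStepOfCoreGuardedChain` (CONSUMED; its v1.1 `prop8StepCoPG_of_…` doors
— CLAIM-3 I.37707 — are the N = 2 stub-text doors; §2 here is the `N`-generic ∃-packaging of THIS head's hypotheses, no overlap in declarations); n07-w3 g7
`N07HalvingBudgetS3` (`exists_guardConstants`, `exists_halvingBudget_S3_guard` — the guard constants and the order of choices; cited, not restated).

References: [15] (144) p. 300, (157)–(159) pp. 302–303, (162)–(166) pp. 303–304, (168) p. 304, Prop. 8 p. 304; [6] Prop. 6 p. 99, (1.3)–(1.9) p. 77, (1.54) p. 85;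
[4] (2.1)–(2.4) p. 224, Cor. 2.8 p. 249.
-/

set_option autoImplicit false

noncomputable section
open scoped BigOperators Matrix.Norms.L2Operator

namespace Summit.QuantumFields.YangMills.BalabanUVNodes.N07SplitClauseHeadStub1G

open Literature.MathematicalPhysics.QuantumFieldTheory.Balaban1983to89
open Literature.MathematicalPhysics.QuantumFieldTheory.Balaban1983to89.Node00
open Literature.MathematicalPhysics.QuantumFieldTheory.Balaban1983to89.B15DeterminingSets
open Literature.MathematicalPhysics.QuantumFieldTheory.Balaban1983to89.B12RegularSpaces111 (gaugeU expI grad)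
open B15Eq112TorusCover (cover)
open B14DomainGeom (Pt Within)
open B14.Eq213MaximalDomains (side cubeExt)
open B5Eq117TorusCarriers (Mk)
open B5Eq118OneStroke (iterBlockOf)
open B5Prop12FieldsLattice (distSite)
open B8Eq131Cubes (sqLo sqHi box cube)
open B8LeafModelZd (ZdIdx)
open B11Eq115Space (levOf)
open B6SectADomainsV1 (Domains)
open B6SectAOperatorsV1 (BondIdx RE dsE QpE)
open Literature.MathematicalPhysics.QuantumFieldTheory.BalabanImbrieJaffe1984to88.BIJ85AxialPropagator411 (BondSpace)
open T4Continuum (T4Family)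
open T4AxialGaugeSmallField (castSite)
open B16Sect1Backgrounds (toMS)
open GaugeField (gaugeAct)
open MatrixLog (mlog)
open Summit.QuantumFields.YangMills.Theorems.K0FlatCubeOpsTextP (flatH)
open Summit.QuantumFields.YangMills.BalabanUVNodes.N07HalvingStepTopOfLocalLetters (Letters10On)
open Summit.QuantumFields.YangMills.BalabanUVNodes.N07SplitClauseHeadKnit (datumGaugeSplitTopStepCoreG_of_prop6P_of_chart)
open Summit.QuantumFields.YangMills.Theorems.K0HalvingStepOfCoreGuardedChain (prop8RegSepTopStepG_of_datumGaugeSplitCoreG)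

/-! ## §1  Prop. 8's top step at the V20-G guard, modulo [6] Prop. 6, `HCHART`, the budget and the smallness letters -/

open scoped Classical in
/-- ★★★ **`Prop8RegSepTopStepG` AT THE PLAN's V20-G GUARD, CLOSED MODULO [6] Prop. 6, `HCHART`, `HLETTERS`∕`HBUDGET` AND THE SMALLNESS LETTERS** — FILE 5's knit
`datumGaugeSplitTopStepCoreG_of_prop6P_of_chart` ∘ k0-s1-w3's guarded chain `prop8RegSepTopStepG_of_datumGaugeSplitCoreG` (`2L² ≤ B₃`, `4C ≤ B₃`, `16θ ≤ 1`, `0 ≤ Q`,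
`(16Q + 1024κ²)a₀ ≤ 1`, `32κa₀ ≤ 1`, `κ := b9OfP F Mc ρ B₁ > 0`).
[cite: Balaban1985Variational, Prop. 8 p.304, (162)–(168) pp.303–304, (157)–(159) pp.302–303; Balaban1985RegularSpaces, Prop. 6 p.99, (1.7)–(1.9) p.77, (1.54) p.85; Balaban1987RG1, (0.1) p.251] -/
theorem prop8RegSepTopStepG_of_prop6P_of_chart (F : T4Family) (N : ℕ) [NeZero N] :
    ∃ (Mh₀ R₀ : ℕ) (CS BS CH δH BH : ℝ), 0 ≤ CS ∧ 0 < BS ∧ 0 ≤ CH ∧ 0 < δH ∧ 0 < BH ∧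
    ∀ {B₁ c₁ : ℝ} (_ : 0 ≤ B₁) (_ : 0 < c₁) {ρ : ℕ}
      (_ : letI : CStarAlgebra (MatA N) := {}; B8.Prop6Printed 4 (F.L : ℝ) B₁ c₁ (fun i : ZdIdx 4 F.L => zdCubP (MatA N) F.L ρ i))
      -- structural letters: grid cube `Mc`, block height `a′` (`M_h = L^{a′} ≥ M_h⁰`), `R ≥ R₀`, the collar `ρ` with `L·M_h ∣ ρ`, `R·L·M_h ≤ ρ`, `L ≤ ρ`
      {Mc Mh R a' : ℕ} (_ : 1 ≤ Mc) (_ : Mh = F.L ^ a') (_ : Mh₀ ≤ Mh) (_ : R₀ ≤ R) (_ : F.L * Mh ∣ ρ) (_ : R * (F.L * Mh) ≤ ρ) (hLρ : F.L ≤ ρ)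
      -- the two constants of the plan's V20-G guard `c ≤ ν.M₁ ∧ k + c₀ ≤ F.m + K` and their side conditions, stated once (n07-w3 g7's two + the head's two)
      {c c₀ : ℕ} (_ : (11 * 4 + 4 * ρ + Mc + 3) * F.L ≤ c) (_ : Mc + 11 * 4 + 6 * ρ ≤ 2 * F.L ^ c₀) (_ : F.m ≤ c₀) (_ : a' + 3 ≤ c₀)
      -- the token's letters, `0 < B₃`, `a₀ ≤ a0OfP`, the (163)-type letter `θ_H` of the `H` doors
      {B₃ C θ Q a₀ a₁ θH : ℝ} (_ : 0 < B₃) (_ : a₀ ≤ a0OfP F N Mc ρ B₁ c₁) (_ : 8 * CH * BH * Real.exp (-(δH * (ρ : ℝ))) ≤ θH)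
      -- V19's floor `2L² ≤ B₃` and the (162)–(166♭) smallness letters of the R0′ closers, `κ := b9OfP F Mc ρ B₁`
      (_ : 2 * (F.L : ℝ) ^ 2 ≤ B₃) (_ : 4 * C ≤ B₃) (_ : 16 * θ ≤ 1) (_ : 0 ≤ Q) (_ : (16 * Q + 1024 * b9OfP F Mc ρ B₁ ^ 2) * a₀ ≤ 1)
      (_ : 32 * b9OfP F Mc ρ B₁ * a₀ ≤ 1)
      -- the chart side's PER-LEVEL SIZE LETTERS, functions of the letters `(ε, δ)` and the level only
      (β₁ β₂ s' σ t₁ : (ℕ → ℝ) → (ℕ → ℝ) → ℕ → ℝ) (v av : (ℕ → ℝ) → (ℕ → ℝ) → ℕ → ℕ → ℝ)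
      (_ : ∀ (K : ℕ) (ε δ : ℕ → ℝ) (j : ℕ), 0 ≤ β₁ ε δ j ∧ 0 ≤ β₂ ε δ j ∧ 0 ≤ s' ε δ j ∧ σ ε δ j ≤ 1 / 2 ∧ (∀ i, 0 ≤ v ε δ j i) ∧ (∀ i, 0 ≤ av ε δ j i) ∧
        (∀ i ≤ j, (((F.P K).d * ((sideP (F.P K) Mc ρ + 4 * ρ + 3) * (F.P K).L ^ (j - i)) : ℕ) : ℝ) * (v ε δ j i + av ε δ j i) ≤ σ ε δ j))
      -- ★ HBUDGET: thresholds above the doors' floors summing below the token's threshold, at every level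
      (_ : ∀ (K : ℕ) (ε δ : ℕ → ℝ) (j : ℕ), ∃ t₂ t₃ tD : ℝ,
        1 / 4 * ((sideP (F.P K) Mc ρ : ℕ) : ℝ) * max (4 * CH * BH * β₁ ε δ j) (θH * (β₂ ε δ j / ((sideP (F.P K) Mc ρ : ℕ) : ℝ))) < t₂ ∧
        1 / 4 * max (4 * CH * BH * s' ε δ j) (θH * s' ε δ j) < t₃ ∧ 2 * CS * BS * (4 * σ ε δ j) < tD ∧
        t₁ ε δ j + (t₂ + tD) + t₃ ≤ C * δ j + θ * ε j + Q * ε j ^ 2)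
      -- ★ HCHART: the chart lane's per-datum deliverable (see FILE 4), at every datum of the token and every output of n07-w3's door
      (_ : ∀ (ν : Stage7Numerics) (M : ℕ) (g : ℕ → ℝ) (K k : ℕ) (s : SeqOfRecord F ν M g K k), Sect2.SeqSeparated ν.M₁ s → 0 < ν.M₁ →
        c ≤ ν.M₁ ∧ k + c₀ ≤ F.m + K → 1 ≤ k →
        ∀ (ε δ : ℕ → ℝ),
        (∀ n, n ≤ k → 0 < δ n ∧ δ n ≤ a₁) → (∀ n, n < k → δ n ≤ 2 * δ (n + 1)) → (∀ n, n < k → δ (n + 1) ≤ 2 * δ n) →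
        (∀ n, n ≤ k → B₃ * δ n ≤ ε n ∧ ε n ≤ a₀) → (∀ n, n < k → ε n ≤ 2 * ε (n + 1)) → (∀ n, n < k → ε (n + 1) ≤ 2 * ε n) →
        ∀ W : MSField (F.P K) (SU N), Sect2.DataSmall7PTop (avOfRecord F N K) s.Ω (suppDomOfRecord F ν K s.Ω) k δ W →
        ∀ U : GaugeField (F.P K) 0 (SU N),
        (∀ n, n ≤ k → PlaqSmallOn (Sect2.omegaPlaqsTop s.Ω (suppDomOfRecord F ν K s.Ω) n) (ε n * (F.P K).eta n ^ 2) U) →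
        (∀ n, n ≤ k → Sect2.CoDivSmallOn (Sect2.omegaBondsTop s.Ω (suppDomOfRecord F ν K s.Ω) n) (ε n * (F.P K).eta n ^ 3) U) →
        AgreeOn (genSet s.Ω k) (avgFamily (avOfRecord F N K) U) W → IsCritOnFibre F N K (genSet s.Ω k) W U →
        ∀ (n : ℕ) (hk : K - n ≤ (F.P K).m + (F.P K).K), 1 ≤ K - n → K - n ≤ k → ∀ (idx : Pt (F.P K).d),
        ∀ {HVd : Domains (F.P K)} (_ : HVd = cubeDomains (F.P K) (cornerP (F.P K) Mc ρ idx) (sideP (F.P K) Mc ρ) ρ (K - n) hk)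
          (lo hi : ℕ → Pt (F.P K).d),
        lo 0 = (fun i => ((F.P K).L : ℤ) * (sqLo (F.P K).L (cornerP (F.P K) Mc ρ idx) ρ (K - n) 1 i - 1)) →
        hi 0 = (fun i => ((F.P K).L : ℤ) * (sqHi (F.P K).L (cornerP (F.P K) Mc ρ idx) (sideP (F.P K) Mc ρ) ρ (K - n) 1 i + 1) + (((F.P K).L : ℤ) - 1)) →
        (∀ j', 1 ≤ j' → lo j' = sqLo (F.P K).L (cornerP (F.P K) Mc ρ idx) ρ (K - n) j' - 1) →
        (∀ j', 1 ≤ j' → hi j' = sqHi (F.P K).L (cornerP (F.P K) Mc ρ idx) (sideP (F.P K) Mc ρ) ρ (K - n) j' + 1) →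
        ∃ HV : (BondIdx HVd → MatA N) →ₗ[ℂ] (PBond (F.P K) 0 → MatA N),
          (∀ (Bf : BondIdx HVd → MatA N) (b : PBond (F.P K) 0), HV Bf b = ∑ c, ((flatH (F.P K) (K - n) HVd (Pi.single c 1) b : ℝ) : ℂ) • Bf c) ∧
        ∀ (u : GaugeTransf (F.P K) 0 (SU N)) (A : PBond (F.P K) 0 → MatA N),
        (∀ b ∈ (Sect2.regionOfSet (F.P K) (cover (F.P K) '' box (F.P K).L (cornerP (F.P K) Mc ρ idx) (sideP (F.P K) Mc ρ) (K - n))).bonds,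
          gaugeU (fun x => ιSU N (u x)) (fun b' => ιSU N (U b')) b = expI ((F.P K).eta (K - n)) (A b)) →
        (∀ b ∈ (Sect2.regionOfSet (F.P K) (cover (F.P K) '' box (F.P K).L (cornerP (F.P K) Mc ρ idx) (sideP (F.P K) Mc ρ) (K - n))).bonds,
          ‖A b‖ < b9OfP F Mc ρ B₁ * ε (K - n)) →
        (∀ q ∈ (Sect2.regionOfSet (F.P K) (cover (F.P K) '' box (F.P K).L (cornerP (F.P K) Mc ρ idx) (sideP (F.P K) Mc ρ) (K - n))).dpairs,
          ‖grad ((F.P K).eta (K - n)) q.2.1 (fun y => A ⟨y, q.2.2⟩) q.1‖ < b9OfP F Mc ρ B₁ * ε (K - n)) →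
        (∀ b ∈ Sect2.bondsDeep (cover (F.P K) '' box (F.P K).L (cornerP (F.P K) Mc ρ idx) (sideP (F.P K) Mc ρ) (K - n)),
          ‖Sect2.codiffCurlA ((F.P K).eta (K - n)) A b.src b.dir‖ < b9OfP F Mc ρ B₁ * ε (K - n)) →
        (∀ b ∈ Sect2.bondsDeep (cover (F.P K) '' box (F.P K).L (cornerP (F.P K) Mc ρ idx) (sideP (F.P K) Mc ρ) (K - n)),
          ‖∑ ν' : Fin (F.P K).d, (((F.P K).eta (K - n) : ℝ) : ℂ)⁻¹ •
              (grad ((F.P K).eta (K - n)) ν' (fun y => A ⟨y, b.dir⟩) (b.src.unshift ν') - grad ((F.P K).eta (K - n)) ν' (fun y => A ⟨y, b.dir⟩) b.src)‖ <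
            b9OfP F Mc ρ B₁ * ε (K - n)) →
        (∀ D' : Domains (F.P K), LinearMap.ker (QpE D') ≤ LinearMap.ker (QpE HVd) → ∀ φ : MatA N →L[ℂ] ℂ,
          RE D' ((F.P K).eta (K - n))⁻¹ (dsE ((F.P K).eta (K - n))⁻¹ (WithLp.toLp 2 fun b => (φ (A b)).re : BondSpace (F.P K))) = 0 ∧
          RE D' ((F.P K).eta (K - n))⁻¹ (dsE ((F.P K).eta (K - n))⁻¹ (WithLp.toLp 2 fun b => (φ (A b)).im : BondSpace (F.P K))) = 0) →
        ∃ (xc : Pt (F.P K).d) (B B' : BondIdx HVd → MatA N) (A₁ : PBond (F.P K) 0 → MatA N)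
          (uL : GaugeTransf (F.P K) 0 (SU N)) (U₁ : GaugeField (F.P K) 0 (SU N)) (lam : (j : ℕ) → Site (F.P K) j → MatA N) (X : BondIdx HVd → MatA N),
          xc ∈ box (F.P K).L (cornerP (F.P K) Mc ρ idx) (sideP (F.P K) Mc ρ) (K - n) ∧
          (∀ c : BondIdx HVd, (c.1.1 : ℕ) = K - n →
            ‖B c‖ ≤ β₁ ε δ (K - n) * (distSite (Mk (F.P K) (c.1.1 : ℕ)) c.1.2.src (iterBlockOf (c.1.1 : ℕ) (cover (F.P K) xc)) + 1)) ∧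
          (∀ c : BondIdx HVd, (c.1.1 : ℕ) < K - n → ‖B c‖ ≤ β₂ ε δ (K - n)) ∧
          (∀ c, ‖B' c‖ ≤ s' ε δ (K - n)) ∧
          (∀ j' ≤ K - n, ∀ c : PBond (F.P K) j', c.src ∈ (castSite '' Set.Icc (lo j') (hi j') : Set (Site (F.P K) j')) →
            c.tgt ∈ (castSite '' Set.Icc (lo j') (hi j') : Set (Site (F.P K) j')) →
              dist1 (Averaging.iter (avOfRecord F N K) j' (gaugeAct uL U₁) c) ≤ v ε δ (K - n) j') ∧
          (∀ j' ≤ K - n, ∀ c : PBond (F.P K) j', c.src ∈ (castSite '' Set.Icc (lo j') (hi j') : Set (Site (F.P K) j')) →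
            c.tgt ∈ (castSite '' Set.Icc (lo j') (hi j') : Set (Site (F.P K) j')) → dist1 (Averaging.iter (avOfRecord F N K) j' U₁ c) ≤ av ε δ (K - n) j') ∧
          (∀ (j' : ℕ) (y : Site (F.P K) j'), ‖lam j' y‖ ≤ ‖mlog (((((toMS uL j' (castSite (lo j')))⁻¹ * toMS uL j' y)⁻¹ : SU N)) : MatA N)‖) ∧
          (∀ c : BondIdx HVd, X c = LatticeFieldCalculus.grad (((F.P K).L : ℝ) ^ (K - n) / ((F.P K).L : ℝ) ^ (c.1.1 : ℕ)) (lam c.1.1) c.1.2) ∧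
          Letters10On (cover (F.P K) '' box (F.P K).L (cornerP (F.P K) Mc ρ idx) (sideP (F.P K) Mc ρ) (K - n)) ((F.P K).eta (K - n)) (t₁ ε δ (K - n)) A₁ ∧
          (∀ b, A b - HV X b = A₁ b + HV B b - HV B' b)),
      Prop8RegSepTopStepG F N (fun ν K Ω => suppDomOfRecord F ν K Ω) (fun ν _ _ K k _ => c ≤ ν.M₁ ∧ k + c₀ ≤ F.m + K) B₃ a₀ a₁ := by
  obtain ⟨Mh₀, R₀, CS, BS, CH, δH, BH, hCS, hBS, hCH, hδH, hBH, hmain⟩ := datumGaugeSplitTopStepCoreG_of_prop6P_of_chart F N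
  refine ⟨Mh₀, R₀, CS, BS, CH, δH, BH, hCS, hBS, hCH, hδH, hBH, ?_⟩
  intro B₁ c₁ hB₁ hc₁ ρ hP6 Mc Mh R a' hMc hMha hMh hR hdvd hRρ hLρ c c₀ hc hc₀ hmc₀ hac₀ B₃ C θ Q a₀ a₁ θH hB₃ ha₀ h163 hB₃L hC hθ hQ ha hκa β₁ β₂ s' σ t₁ v av
    hletters hbudget hchart
  exact prop8RegSepTopStepG_of_datumGaugeSplitCoreG hMc hLρ
    (hmain hB₁ hc₁ hP6 hMc hMha hMh hR hdvd hRρ hLρ hc hc₀ hmc₀ hac₀ hB₃ ha₀ h163 β₁ β₂ s' σ t₁ v av hletters hbudget hchart)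
    hB₃L hC hθ hQ (b9OfP_pos (F := F) Mc ρ hB₁).le ha hκa

/-! ## §2  The V20-G stub-1 SHAPE (plan WORD V20 = G), every `N` -/

open scoped Classical in
/-- ★★★ **THE V20-G STUB-1 SHAPE, CLOSED MODULO [6] Prop. 6, `HCHART`, THE BUDGET AND THE SMALLNESS LETTERS** — `∃ c c₀ B₃ a₀ a₁, 2L² ≤ B₃ ∧ 0 < a₀ ∧ 0 < a₁ ∧
Prop8RegSepTopStepG F N suppDom (fun ν _ _ K k _ => c ≤ ν.M₁ ∧ k + c₀ ≤ F.m + K) B₃ a₀ a₁` (at `N = 2` the plan's `Prop8StepCoPGAt F`), the witnesses being the letters of §2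
themselves.  No stub is registered or closed by this theorem.
[cite: Balaban1985Variational, Prop. 8 p.304, (162)–(168) pp.303–304; Balaban1985RegularSpaces, Prop. 6 p.99, (1.3)–(1.9) p.77; Balaban1987RG1, (0.1) p.251] -/
theorem prop8StepCoPGShape_of_prop6P_of_chart (F : T4Family) (N : ℕ) [NeZero N] :
    ∃ (Mh₀ R₀ : ℕ) (CS BS CH δH BH : ℝ), 0 ≤ CS ∧ 0 < BS ∧ 0 ≤ CH ∧ 0 < δH ∧ 0 < BH ∧
    ∀ {B₁ c₁ : ℝ} (_ : 0 ≤ B₁) (_ : 0 < c₁) {ρ : ℕ}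
      (_ : letI : CStarAlgebra (MatA N) := {}; B8.Prop6Printed 4 (F.L : ℝ) B₁ c₁ (fun i : ZdIdx 4 F.L => zdCubP (MatA N) F.L ρ i))
      -- structural letters: grid cube `Mc`, block height `a′` (`M_h = L^{a′} ≥ M_h⁰`), `R ≥ R₀`, the collar `ρ` with `L·M_h ∣ ρ`, `R·L·M_h ≤ ρ`, `L ≤ ρ`
      {Mc Mh R a' : ℕ} (_ : 1 ≤ Mc) (_ : Mh = F.L ^ a') (_ : Mh₀ ≤ Mh) (_ : R₀ ≤ R) (_ : F.L * Mh ∣ ρ) (_ : R * (F.L * Mh) ≤ ρ) (hLρ : F.L ≤ ρ)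
      -- the two constants of the plan's V20-G guard `c ≤ ν.M₁ ∧ k + c₀ ≤ F.m + K` and their side conditions, stated once (n07-w3 g7's two + the head's two)
      {c c₀ : ℕ} (_ : (11 * 4 + 4 * ρ + Mc + 3) * F.L ≤ c) (_ : Mc + 11 * 4 + 6 * ρ ≤ 2 * F.L ^ c₀) (_ : F.m ≤ c₀) (_ : a' + 3 ≤ c₀)
      -- the token's letters, `0 < B₃`, `a₀ ≤ a0OfP`, the (163)-type letter `θ_H` of the `H` doors
      {B₃ C θ Q a₀ a₁ θH : ℝ} (_ : 0 < B₃) (_ : a₀ ≤ a0OfP F N Mc ρ B₁ c₁) (_ : 8 * CH * BH * Real.exp (-(δH * (ρ : ℝ))) ≤ θH)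
      -- V19's floor `2L² ≤ B₃` and the (162)–(166♭) smallness letters of the R0′ closers, `κ := b9OfP F Mc ρ B₁`
      (_ : 2 * (F.L : ℝ) ^ 2 ≤ B₃) (_ : 4 * C ≤ B₃) (_ : 16 * θ ≤ 1) (_ : 0 ≤ Q) (_ : (16 * Q + 1024 * b9OfP F Mc ρ B₁ ^ 2) * a₀ ≤ 1)
      (_ : 32 * b9OfP F Mc ρ B₁ * a₀ ≤ 1) (_ : 0 < a₀) (_ : 0 < a₁)
      -- the chart side's PER-LEVEL SIZE LETTERS, functions of the letters `(ε, δ)` and the level only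
      (β₁ β₂ s' σ t₁ : (ℕ → ℝ) → (ℕ → ℝ) → ℕ → ℝ) (v av : (ℕ → ℝ) → (ℕ → ℝ) → ℕ → ℕ → ℝ)
      (_ : ∀ (K : ℕ) (ε δ : ℕ → ℝ) (j : ℕ), 0 ≤ β₁ ε δ j ∧ 0 ≤ β₂ ε δ j ∧ 0 ≤ s' ε δ j ∧ σ ε δ j ≤ 1 / 2 ∧ (∀ i, 0 ≤ v ε δ j i) ∧ (∀ i, 0 ≤ av ε δ j i) ∧
        (∀ i ≤ j, (((F.P K).d * ((sideP (F.P K) Mc ρ + 4 * ρ + 3) * (F.P K).L ^ (j - i)) : ℕ) : ℝ) * (v ε δ j i + av ε δ j i) ≤ σ ε δ j))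
      -- ★ HBUDGET: thresholds above the doors' floors summing below the token's threshold, at every level
      (_ : ∀ (K : ℕ) (ε δ : ℕ → ℝ) (j : ℕ), ∃ t₂ t₃ tD : ℝ,
        1 / 4 * ((sideP (F.P K) Mc ρ : ℕ) : ℝ) * max (4 * CH * BH * β₁ ε δ j) (θH * (β₂ ε δ j / ((sideP (F.P K) Mc ρ : ℕ) : ℝ))) < t₂ ∧
        1 / 4 * max (4 * CH * BH * s' ε δ j) (θH * s' ε δ j) < t₃ ∧ 2 * CS * BS * (4 * σ ε δ j) < tD ∧
        t₁ ε δ j + (t₂ + tD) + t₃ ≤ C * δ j + θ * ε j + Q * ε j ^ 2)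
      -- ★ HCHART: the chart lane's per-datum deliverable (see FILE 4), at every datum of the token and every output of n07-w3's door
      (_ : ∀ (ν : Stage7Numerics) (M : ℕ) (g : ℕ → ℝ) (K k : ℕ) (s : SeqOfRecord F ν M g K k), Sect2.SeqSeparated ν.M₁ s → 0 < ν.M₁ →
        c ≤ ν.M₁ ∧ k + c₀ ≤ F.m + K → 1 ≤ k →
        ∀ (ε δ : ℕ → ℝ),
        (∀ n, n ≤ k → 0 < δ n ∧ δ n ≤ a₁) → (∀ n, n < k → δ n ≤ 2 * δ (n + 1)) → (∀ n, n < k → δ (n + 1) ≤ 2 * δ n) →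
        (∀ n, n ≤ k → B₃ * δ n ≤ ε n ∧ ε n ≤ a₀) → (∀ n, n < k → ε n ≤ 2 * ε (n + 1)) → (∀ n, n < k → ε (n + 1) ≤ 2 * ε n) →
        ∀ W : MSField (F.P K) (SU N), Sect2.DataSmall7PTop (avOfRecord F N K) s.Ω (suppDomOfRecord F ν K s.Ω) k δ W →
        ∀ U : GaugeField (F.P K) 0 (SU N),
        (∀ n, n ≤ k → PlaqSmallOn (Sect2.omegaPlaqsTop s.Ω (suppDomOfRecord F ν K s.Ω) n) (ε n * (F.P K).eta n ^ 2) U) →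
        (∀ n, n ≤ k → Sect2.CoDivSmallOn (Sect2.omegaBondsTop s.Ω (suppDomOfRecord F ν K s.Ω) n) (ε n * (F.P K).eta n ^ 3) U) →
        AgreeOn (genSet s.Ω k) (avgFamily (avOfRecord F N K) U) W → IsCritOnFibre F N K (genSet s.Ω k) W U →
        ∀ (n : ℕ) (hk : K - n ≤ (F.P K).m + (F.P K).K), 1 ≤ K - n → K - n ≤ k → ∀ (idx : Pt (F.P K).d),
        ∀ {HVd : Domains (F.P K)} (_ : HVd = cubeDomains (F.P K) (cornerP (F.P K) Mc ρ idx) (sideP (F.P K) Mc ρ) ρ (K - n) hk)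
          (lo hi : ℕ → Pt (F.P K).d),
        lo 0 = (fun i => ((F.P K).L : ℤ) * (sqLo (F.P K).L (cornerP (F.P K) Mc ρ idx) ρ (K - n) 1 i - 1)) →
        hi 0 = (fun i => ((F.P K).L : ℤ) * (sqHi (F.P K).L (cornerP (F.P K) Mc ρ idx) (sideP (F.P K) Mc ρ) ρ (K - n) 1 i + 1) + (((F.P K).L : ℤ) - 1)) →
        (∀ j', 1 ≤ j' → lo j' = sqLo (F.P K).L (cornerP (F.P K) Mc ρ idx) ρ (K - n) j' - 1) →
        (∀ j', 1 ≤ j' → hi j' = sqHi (F.P K).L (cornerP (F.P K) Mc ρ idx) (sideP (F.P K) Mc ρ) ρ (K - n) j' + 1) →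
        ∃ HV : (BondIdx HVd → MatA N) →ₗ[ℂ] (PBond (F.P K) 0 → MatA N),
          (∀ (Bf : BondIdx HVd → MatA N) (b : PBond (F.P K) 0), HV Bf b = ∑ c, ((flatH (F.P K) (K - n) HVd (Pi.single c 1) b : ℝ) : ℂ) • Bf c) ∧
        ∀ (u : GaugeTransf (F.P K) 0 (SU N)) (A : PBond (F.P K) 0 → MatA N),
        (∀ b ∈ (Sect2.regionOfSet (F.P K) (cover (F.P K) '' box (F.P K).L (cornerP (F.P K) Mc ρ idx) (sideP (F.P K) Mc ρ) (K - n))).bonds,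
          gaugeU (fun x => ιSU N (u x)) (fun b' => ιSU N (U b')) b = expI ((F.P K).eta (K - n)) (A b)) →
        (∀ b ∈ (Sect2.regionOfSet (F.P K) (cover (F.P K) '' box (F.P K).L (cornerP (F.P K) Mc ρ idx) (sideP (F.P K) Mc ρ) (K - n))).bonds,
          ‖A b‖ < b9OfP F Mc ρ B₁ * ε (K - n)) →
        (∀ q ∈ (Sect2.regionOfSet (F.P K) (cover (F.P K) '' box (F.P K).L (cornerP (F.P K) Mc ρ idx) (sideP (F.P K) Mc ρ) (K - n))).dpairs,
          ‖grad ((F.P K).eta (K - n)) q.2.1 (fun y => A ⟨y, q.2.2⟩) q.1‖ < b9OfP F Mc ρ B₁ * ε (K - n)) →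
        (∀ b ∈ Sect2.bondsDeep (cover (F.P K) '' box (F.P K).L (cornerP (F.P K) Mc ρ idx) (sideP (F.P K) Mc ρ) (K - n)),
          ‖Sect2.codiffCurlA ((F.P K).eta (K - n)) A b.src b.dir‖ < b9OfP F Mc ρ B₁ * ε (K - n)) →
        (∀ b ∈ Sect2.bondsDeep (cover (F.P K) '' box (F.P K).L (cornerP (F.P K) Mc ρ idx) (sideP (F.P K) Mc ρ) (K - n)),
          ‖∑ ν' : Fin (F.P K).d, (((F.P K).eta (K - n) : ℝ) : ℂ)⁻¹ •
              (grad ((F.P K).eta (K - n)) ν' (fun y => A ⟨y, b.dir⟩) (b.src.unshift ν') - grad ((F.P K).eta (K - n)) ν' (fun y => A ⟨y, b.dir⟩) b.src)‖ <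
            b9OfP F Mc ρ B₁ * ε (K - n)) →
        (∀ D' : Domains (F.P K), LinearMap.ker (QpE D') ≤ LinearMap.ker (QpE HVd) → ∀ φ : MatA N →L[ℂ] ℂ,
          RE D' ((F.P K).eta (K - n))⁻¹ (dsE ((F.P K).eta (K - n))⁻¹ (WithLp.toLp 2 fun b => (φ (A b)).re : BondSpace (F.P K))) = 0 ∧
          RE D' ((F.P K).eta (K - n))⁻¹ (dsE ((F.P K).eta (K - n))⁻¹ (WithLp.toLp 2 fun b => (φ (A b)).im : BondSpace (F.P K))) = 0) →
        ∃ (xc : Pt (F.P K).d) (B B' : BondIdx HVd → MatA N) (A₁ : PBond (F.P K) 0 → MatA N)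
          (uL : GaugeTransf (F.P K) 0 (SU N)) (U₁ : GaugeField (F.P K) 0 (SU N)) (lam : (j : ℕ) → Site (F.P K) j → MatA N) (X : BondIdx HVd → MatA N),
          xc ∈ box (F.P K).L (cornerP (F.P K) Mc ρ idx) (sideP (F.P K) Mc ρ) (K - n) ∧
          (∀ c : BondIdx HVd, (c.1.1 : ℕ) = K - n →
            ‖B c‖ ≤ β₁ ε δ (K - n) * (distSite (Mk (F.P K) (c.1.1 : ℕ)) c.1.2.src (iterBlockOf (c.1.1 : ℕ) (cover (F.P K) xc)) + 1)) ∧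
          (∀ c : BondIdx HVd, (c.1.1 : ℕ) < K - n → ‖B c‖ ≤ β₂ ε δ (K - n)) ∧
          (∀ c, ‖B' c‖ ≤ s' ε δ (K - n)) ∧
          (∀ j' ≤ K - n, ∀ c : PBond (F.P K) j', c.src ∈ (castSite '' Set.Icc (lo j') (hi j') : Set (Site (F.P K) j')) →
            c.tgt ∈ (castSite '' Set.Icc (lo j') (hi j') : Set (Site (F.P K) j')) →
              dist1 (Averaging.iter (avOfRecord F N K) j' (gaugeAct uL U₁) c) ≤ v ε δ (K - n) j') ∧
          (∀ j' ≤ K - n, ∀ c : PBond (F.P K) j', c.src ∈ (castSite '' Set.Icc (lo j') (hi j') : Set (Site (F.P K) j')) →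
            c.tgt ∈ (castSite '' Set.Icc (lo j') (hi j') : Set (Site (F.P K) j')) → dist1 (Averaging.iter (avOfRecord F N K) j' U₁ c) ≤ av ε δ (K - n) j') ∧
          (∀ (j' : ℕ) (y : Site (F.P K) j'), ‖lam j' y‖ ≤ ‖mlog (((((toMS uL j' (castSite (lo j')))⁻¹ * toMS uL j' y)⁻¹ : SU N)) : MatA N)‖) ∧
          (∀ c : BondIdx HVd, X c = LatticeFieldCalculus.grad (((F.P K).L : ℝ) ^ (K - n) / ((F.P K).L : ℝ) ^ (c.1.1 : ℕ)) (lam c.1.1) c.1.2) ∧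
          Letters10On (cover (F.P K) '' box (F.P K).L (cornerP (F.P K) Mc ρ idx) (sideP (F.P K) Mc ρ) (K - n)) ((F.P K).eta (K - n)) (t₁ ε δ (K - n)) A₁ ∧
          (∀ b, A b - HV X b = A₁ b + HV B b - HV B' b)),
      ∃ (c' c₀' : ℕ) (B₃' a₀' a₁' : ℝ), 2 * (F.L : ℝ) ^ 2 ≤ B₃' ∧ 0 < a₀' ∧ 0 < a₁' ∧
        Prop8RegSepTopStepG F N (fun ν K Ω => suppDomOfRecord F ν K Ω) (fun ν _ _ K k _ => c' ≤ ν.M₁ ∧ k + c₀' ≤ F.m + K) B₃' a₀' a₁' := by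
  obtain ⟨Mh₀, R₀, CS, BS, CH, δH, BH, hCS, hBS, hCH, hδH, hBH, hmain⟩ := prop8RegSepTopStepG_of_prop6P_of_chart F N
  refine ⟨Mh₀, R₀, CS, BS, CH, δH, BH, hCS, hBS, hCH, hδH, hBH, ?_⟩
  intro B₁ c₁ hB₁ hc₁ ρ hP6 Mc Mh R a' hMc hMha hMh hR hdvd hRρ hLρ c c₀ hc hc₀ hmc₀ hac₀ B₃ C θ Q a₀ a₁ θH hB₃ ha₀ h163 hB₃L hC hθ hQ ha hκa ha₀' ha₁ β₁ β₂ s' σ t₁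
    v av hletters hbudget hchart
  exact ⟨c, c₀, B₃, a₀, a₁, hB₃L, ha₀', ha₁,
    hmain hB₁ hc₁ hP6 hMc hMha hMh hR hdvd hRρ hLρ hc hc₀ hmc₀ hac₀ hB₃ ha₀ h163 hB₃L hC hθ hQ ha hκa β₁ β₂ s' σ t₁ v av hletters hbudget hchart⟩

end Summit.QuantumFields.YangMills.BalabanUVNodes.N07SplitClauseHeadStub1G

end
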